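import Summits.AtomisticToContinuum.Crystallization.Theorems.ShellCensus.Negative.MatchingDegree
import Literature.Barriers.AtomisticToContinuum.IcosahedralClusters

/-!
# Disproof of `ShellTrichotomy` (stmt-AtomisticToContinuum-18070) — findings

Crux (route `GappedShellCensus`, rank 4, computational): every gapped twelve-shell `T` (12 points, radii
in `[49/50, 51/50]`, pair distances in `[49/50, 51/50] ∪ [63/50, ∞)`) is (A) `1/5`-close after a linear
isometry to the fcc or hcp kissing pattern, or (B) capped (a vertex with `≥ 5` shell points within
`51/50`), or (C) torn (a vertex with `≤ 3`).  A counterexample must therefore be ALL-DEGREE-4 and have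
bottleneck distance `> 1/5` from both patterns under every rotation (for `η = 1/5 < 1/2` the matching
is automatic: `T` is `η`-close to `P` iff some rotation puts every point of `T` within `η` of `P`).

**VERDICT OF THIS CYCLE: NO KILL — the crux resists, with thin margins.**  Disprover seat
refuter-cdisprove-stmt-AtomisticToContinuum-18070-0, 2026-08-17 (cycle 1).  Numbers, sources:

1. COMBINATORICS (exact; kit j022304, 28 s; local `compute/medial86b.py` for the `(8,6)` part): the
   4-regular plane maps on 12 vertices that are medials of SIMPLE plane graphs with 12 edges (all of
   them but possibly medials of an `H` with a double edge) are EXACTLY TWELVE: five `(8,6)` maps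
   [cuboctahedron `TQTQ×12`; anticuboctahedron `TQTQ×6 TTQQ×6`; three with a `3T+Q` word:
   `map0 TTTQ×2 TTQQ×6 TQQQ×2 TQTQ×2`, `map1 = medial(J7) TTTQ×6 TQQQ×6`, `map3 TTTQ×4 TTQQ×4 TQQQ×4`],
   two `(9,4,1)` [one with a `4T` vertex, one with `3T+Q`], three `(10,2,2)` [two with `3T+Q`, one with
   `4T`], two `(12,0,0,2)` [the antiprism type, all twelve words `3T+H`; one with `4T`].  (rattack's
   triangulation census has 13 = these + one more `4T` map.)  HENCE: every all-degree-4 bond map other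
   than cubo / anticubo / the two-hexagon antiprism map carries a `4T` or a `3T+Q` vertex word, and the
   crux at `τ = 1/50` REDUCES to four checkable pieces: (i) `4T` locally infeasible (azimuth sum
   `≤ 4·76.3° < 360°`, huge margin); (ii) `3T+Q` locally infeasible (6-point problem; numerically dead for
   `τ ≤ 0.024`, alive from `0.026` — kit j022014 D; margin in `τ` only `≈ 0.005`, but LOCAL, so an
   interval certificate is cheap); (iii) the all-`3T+H` two-hexagon map globally infeasible (`τ* ≈ 0.0425`,
   j022014 C); (iv) the bottleneck bound `< 1/5` on the cubo/anticubo flex families (item 3: `0.1833`,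
   margin `0.0167` — the genuinely hard piece).  The link-path obstruction below kills branch (A) for
   any `3T`-fanned map whose fan bonds are `< √2 − 2/5 = 1.0142`; what keeps the crux alive is that such
   maps do not REALISE at `τ = 1/50` with the `63/50` gap:
2. REALISABILITY THRESHOLDS (numerical, kit j022014, L-BFGS multistart + bisection on `τ`, gap fixed):
   `3T+Q` word dead for `τ ≤ 0.024`, alive from `0.026` (rattack/ideator: `0.0242`); `3T+P` word ALIVE at
   `0.02` (pentagon maps die only through their `3T+Q`/`4T` vertices or globally); map0 `τ* ≈ 0.034`,
   map1 `0.064`, map3 `0.051`; two-hexagon `0.0425`; cubo double-swap `(10,2,2)` `0.033`; hcp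
   double-swaps `(9,4,1)` `0.045`, `(8,6)` = map0 `0.034`.  GRAPH-FREE random search for gapped shells at
   `τ = 0.02` (j022014 E): 26 877 starts, 4 544 feasible gapped shells in ≥ 40 degree classes, 581 of them
   all-degree-4 — EVERY one cubo/anticubo-worded, largest bottleneck distance `0.151`.  Independent of
   and consistent with refuter-rattack-18070-0 (13 maps, thresholds `0.032–0.06`).
3. THE (A)-BRANCH MARGIN (numerical, kit j021991, nonsmooth ascent with envelope gradients over the
   competitor rotations, basin hopping, 4 workers): the largest bottleneck distance of a feasible
   hcp-graph shell from BOTH patterns is `D* ≈ 0.18328` (eight independent seeds converge to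
   `0.18323–0.18328`; the previous attacker's `0.1765` understates it); fcc-graph family lower.
   MARGIN `1/5 − D* ≈ 0.0167` — thin but clearly positive.  The maximiser is the counter-rotating-cupolae
   twist of the anticuboctahedron pushed to the quad-diagonal gap `63/50` with the bond slop spent
   (integer coordinates: `MaxHcpInt` below; radii at both ends of the window, 8 bonds at `1.02`, 3 at
   `0.98`, five far pairs at `1.2600x`).  WITHOUT the gap the same ascent reaches `0.2608` (hcp graph)
   and `0.2360` (fcc graph), both `> 1/5` (kit j022094): the gap is what keeps branch (A) true.
4. WHY IT RESISTS (mechanism): along the one soft mode of either pattern the quad diagonals shrink at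
   FIRST order (`d/dψ ≈ −0.87` per radian for hcp) while bonds grow only at second order; the gap at
   `63/50` therefore cuts the flex at `ψ ≈ 0.18` (cap displacement `≈ 0.145`), and the `±2 %` bond/radius
   slop buys `≈ 0.04` more — total `≈ 0.183 < 0.2`.  A kill needs either a new basin of the hcp/fcc
   families (none found) or an exotic map at `τ = 0.02` (all need `τ ≳ 0.033`).

## Contents (all `sorry`-free unless marked NEAR-MISS)

(a) LOAD-BEARING HYPOTHESES, as theorems:
* `shellTrichotomy_false_without_hardCore` — drop `49/50 ≤ dist`: FALSE (inscribed regular hexagonal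
  antiprism, bonds `0.92`, all degrees 4, three triangles at every vertex).  Quantitatively
  `not_trichotomyAt_core_091`: already false with the core lowered to `91/100`.
* `shellTrichotomy_false_without_radiusWindow` — drop the radii: FALSE (fcc translated by `(3,0,0)`;
  the conclusion's isometries are linear).
* `shellTrichotomy_false_without_card` — drop `card = 12`: FALSE (`∅`, degenerate).
* The GAP hypothesis `dist ≤ 51/50 ∨ 63/50 ≤ dist`: OPEN here.  It is what kills every exotic map
  (items 1–2) and cuts the soft modes (item 4), but a `τ = 1/50` counterexample to the gap-free variant
  needs either a `3T`-fanned map with short fan bonds (map0 without gap is itself marginal at `0.02`: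
  penalty `3·10⁻⁶`, and its fan bonds sit at `1.02 > 1.0142`) or a certified far point of the gap-free
  hcp/fcc flexes (jitterbug reaches displacement `≈ 0.20` at `τ = 0.02` — borderline, uncertified).
  Recorded as NEAR-MISS `shellTrichotomy_false_without_gap` (sorry).
(b) TIGHTNESS: RIGOROUS `not_trichotomyAt_eta_0075` — `η` cannot be lowered to `3/40`: the gap value
  `63/50` is ATTAINED by a quad diagonal on the feasible set (witness `Wg`, the hcp butterfly twist at
  `ψ = 0.17` projected to feasibility, integer model at `10⁻⁶`, all hypotheses by `decide`), and the
  patterns have no pair distance in `(1, √2)`, so the distance relaxation alone forces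
  `η ≥ (√2 − 63/50)/2 ≈ 0.0771` (`not_shellCloseTo_of_gapPair`, `fcc/hcp_dist_dichotomy`).  NEAR-MISS
  `not_trichotomyAt_eta_018` (sorry) — numerically `η` cannot go below `0.1833` (item 3); certifying
  "far under EVERY rotation" needs a rotation-space subdivision certificate (not built).
(c) NATURAL STRENGTHENINGS REFUTED: `not_trichotomyAt_core_091` (core/radius ratio); the
  six-parameter form `TrichotomyAt` with `shellTrichotomy_iff` (by `Iff.rfl`) and `trichotomyAt_mono`.
(d) TARGETS — line `Sketch` (six stubs): no stub broken; `stub_censusCore` VERIFIED in its finite terms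
  (count-certified enumeration of all 12-vertex sphere triangulations) with `qCorner`, `hCorner` and the coupled
  T bound load-bearing (`stub_censusCore_false_without_qCorner/_hCorner` in the kernel), `bond_tri` not; see §(d).
(e) TOOLS for later seats: `not_shellCloseTo_of_linkPath` (three bonded triangles fanned at a vertex,
  fan bonds `≤ β`, `β + 2η < ρ`, pattern points in `≤ 2` bonded `ρ`-triangles ⇒ not `η`-close) with
  `fcc_triCorners` / `hcp_triCorners` (`ρ = 1.414`); two-sided `√q/D` transfer lemmas.

Landed on the negative lane `Theorems/ShellTrichotomy/Negative/` (namespace `…Theorems.ShellTrichotomyNegative`):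
`LinkPath.lean` = (e) [p138804 ACCEPTED]; `WithoutHardCore.lean` = hard core + (c) [p140093 ACCEPTED];
`WithoutRadiusWindow.lean` = radius window + card [p139575 ACCEPTED]; `GapPair.lean` = (b) rigorous part
[p140185 ACCEPTED]; (d): `CensusCoreTools.lean` [p142875 ACCEPTED], `CensusCoreWithoutQCorner.lean` [p142881 ACCEPTED],
`CensusCoreWithoutHCorner.lean` [p142883 ACCEPTED], `NoAntiprismWithoutRadiusWindow.lean` [p143450 submitted].  This workfile keeps its own namespace (same content) so it elaborates independently.
-/

noncomputable section

namespace Summit.AtomisticToContinuum.Crystallization.Cruxes.ShellTrichotomy.Disproof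

open Literature.Geometry.DiscreteGeometry
open Summit.AtomisticToContinuum.Crystallization.Theorems.ShellCensusNegative

local notation "E3" => EuclideanSpace ℝ (Fin 3)

/-- The ordered "`ρ`-triangle corners" at a pattern point `a`: ordered pairs `(b, c)` of pattern points,
distinct from `a` and from each other, with `ab`, `ac`, `bc` all `< ρ`. [folklore] -/
def triCorners (P : Finset E3) (ρ : ℝ) (a : E3) : Finset (E3 × E3) :=
  (P ×ˢ P).filter fun bc => bc.1 ≠ a ∧ bc.2 ≠ a ∧ bc.1 ≠ bc.2 ∧ dist a bc.1 < ρ ∧ dist a bc.2 < ρ ∧ dist bc.1 bc.2 < ρ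

/-- the six ordered index pairs along the path `0–1–2–3` [folklore] -/
def pathPairs : Finset (Fin 4 × Fin 4) := {(0, 1), (1, 0), (1, 2), (2, 1), (2, 3), (3, 2)}

/-- six index pairs. [folklore] -/
theorem card_pathPairs : pathPairs.card = 6 := by decide

/-- THE LINK-PATH OBSTRUCTION. If every point `a` of the pattern `P` has at most four ordered
`ρ`-triangle corners (i.e. lies in at most two bonded triangles), while the shell `T` has a point `t0`
with four distinct other shell points `n 0, …, n 3` within `β` of it and `n 0 n 1`, `n 1 n 2`, `n 2 n 3`
within `β` (three bonded triangles fanned at `t0`), and `β + 2η < ρ`, then `T` is not `η`-close to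
`P`: an `η`-matching moves points by `≤ η`, hence is injective and stretches distances by `≤ 2η`,
so it would produce six ordered `ρ`-triangle corners at the image of `t0`. [folklore] -/
theorem not_shellCloseTo_of_linkPath {η β ρ : ℝ} {T P : Finset E3}
    (hP : ∀ a ∈ P, (triCorners P ρ a).card ≤ 4) (hβ : β + 2 * η < ρ)
    {t0 : E3} (ht0 : t0 ∈ T) (n : Fin 4 → E3) (hnT : ∀ i, n i ∈ T) (hninj : Function.Injective n)
    (hn0 : ∀ i, n i ≠ t0) (hd0 : ∀ i, dist t0 (n i) ≤ β)
    (h01 : dist (n 0) (n 1) ≤ β) (h12 : dist (n 1) (n 2) ≤ β) (h23 : dist (n 2) (n 3) ≤ β) :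
    ¬ ShellCloseTo η T P := by
  classical
  rintro ⟨A, hA⟩
  obtain ⟨f, hfQ, hfinj, hfd⟩ := exists_map_of_etaMatched hA
  -- the image point and its pattern preimage
  obtain ⟨a, ha, hfa⟩ := Finset.mem_image.1 (hfQ t0 ht0)
  -- distances after the matching
  have hstretch : ∀ x ∈ T, ∀ y ∈ T, dist x y ≤ β → dist (f x) (f y) < ρ := by
    intro x hx y hy hxy
    calc dist (f x) (f y) ≤ dist (f x) x + dist x y + dist y (f y) := dist_triangle4 _ _ _ _
      _ ≤ η + β + η := by
          gcongr
          · rw [dist_comm]; exact hfd x hx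
          · exact hfd y hy
      _ < ρ := by linarith
  have hη0 : 0 ≤ η := le_trans dist_nonneg (hfd t0 ht0)
  -- g = f ∘ n is injective
  have hg : Function.Injective (fun i => f (n i)) := fun i j h => hninj (hfinj _ (hnT i) _ (hnT j) h)
  have hgne : ∀ i, f (n i) ≠ f t0 := fun i h => hn0 i (hfinj _ (hnT i) _ ht0 h)
  -- six ordered corners at f t0, inside the image pattern A '' P
  let S : Finset (E3 × E3) := pathPairs.image fun ij => (f (n ij.1), f (n ij.2))
  have hScard : S.card = 6 := by
    rw [Finset.card_image_of_injective _ ?_, card_pathPairs]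
    intro ij kl h
    simp only [Prod.mk.injEq] at h
    exact Prod.ext (hg h.1) (hg h.2)
  have hSsub : S ⊆ triCorners (P.image A) ρ (f t0) := by
    intro bc hbc
    obtain ⟨ij, hij, rfl⟩ := Finset.mem_image.1 hbc
    have hcases : dist (n ij.1) (n ij.2) ≤ β ∧ ij.1 ≠ ij.2 := by
      simp only [pathPairs, Finset.mem_insert, Finset.mem_singleton] at hij
      rcases hij with h | h | h | h | h | h <;> subst h <;> simp [h01, h12, h23, dist_comm (n 1) (n 0), dist_comm (n 2) (n 1), dist_comm (n 3) (n 2)]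
    simp only [triCorners, Finset.mem_filter, Finset.mem_product]
    refine ⟨⟨hfQ _ (hnT _), hfQ _ (hnT _)⟩, hgne _, hgne _, fun h => hcases.2 (hg h), ?_, ?_, ?_⟩
    · exact hstretch _ ht0 _ (hnT _) (hd0 _)
    · exact hstretch _ ht0 _ (hnT _) (hd0 _)
    · exact hstretch _ (hnT _) _ (hnT _) hcases.1
  have h6 : 6 ≤ (triCorners (P.image A) ρ (f t0)).card := hScard ▸ Finset.card_le_card hSsub
  -- invariance of the corner count under the isometry
  have hinv : (triCorners (P.image A) ρ (A a)).card = (triCorners P ρ a).card := by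
    unfold triCorners
    rw [← Finset.prodMap_image_product, Finset.filter_image,
      Finset.card_image_of_injective _ (A.injective.prodMap A.injective)]
    congr 1
    apply Finset.filter_congr
    intro bc _
    simp [A.injective.ne_iff, LinearIsometry.dist_map]
  rw [← hfa, hinv] at h6
  have := hP a ha
  omega

/-! ### pattern facts: at most two bonded triangles at every point of fcc / hcp -/

/-- integer version of `triCorners` [folklore] -/
def triCornersInt (S : Finset (Fin 3 → ℤ)) (M : ℤ) (a : Fin 3 → ℤ) : Finset ((Fin 3 → ℤ) × (Fin 3 → ℤ)) :=
  (S ×ˢ S).filter fun bc => bc.1 ≠ a ∧ bc.2 ≠ a ∧ bc.1 ≠ bc.2 ∧ sqNormInt (a - bc.1) < M ∧ sqNormInt (a - bc.2) < M ∧ sqNormInt (bc.1 - bc.2) < M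

/-- fcc integer model: every vector lies in exactly two bonded triangles (four ordered corners with all
three squared distances `< 4 = (√2·√2)²`). [cite: ConwaySloane1999, Ch. 4 §6.3] -/
theorem fccInt_triCorners : ∀ a ∈ fccInt, (triCornersInt fccInt 4 a).card ≤ 4 := by decide

/-- hcp integer model (scale `√18`): at most four ordered corners with squared distances `< 36`. [folklore] -/
theorem hcpInt_triCorners : ∀ a ∈ hcpInt, (triCornersInt hcpInt 36 a).card ≤ 4 := by decide


/-- the distance test on a `√N`-scaled integer pattern, in integers (extracted from
`card_near_scaledPattern_le`). [folklore] -/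
theorem sqNormInt_lt_of_dist_scaled_lt {N : ℕ} (hN : N ≠ 0) {M : ℤ} {ρ : ℝ} (hρ : ρ ^ 2 * N ≤ M)
    (v w : Fin 3 → ℤ) (hd : dist ((Real.sqrt N)⁻¹ • intVec v : E3) ((Real.sqrt N)⁻¹ • intVec w) < ρ) :
    sqNormInt (v - w) < M := by
  have hNpos : (0 : ℝ) < N := by exact_mod_cast Nat.pos_of_ne_zero hN
  have hc : (0 : ℝ) ≤ (Real.sqrt N)⁻¹ := by positivity
  rw [dist_scaled_intVec _ hc] at hd
  have hsN : 0 < Real.sqrt N := Real.sqrt_pos.2 hNpos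
  rw [inv_mul_lt_iff₀ hsN] at hd
  have h2 : (sqNormInt (v - w) : ℝ) < (Real.sqrt N * ρ) ^ 2 := by
    by_contra hcon
    push Not at hcon
    have : Real.sqrt N * ρ ≤ Real.sqrt (sqNormInt (v - w) : ℝ) := by
      calc Real.sqrt N * ρ = Real.sqrt ((Real.sqrt N * ρ) ^ 2) := by
            rw [Real.sqrt_sq (by nlinarith [Real.sqrt_nonneg (sqNormInt (v - w) : ℝ)])]
        _ ≤ _ := Real.sqrt_le_sqrt hcon
    linarith
  rw [mul_pow, Real.sq_sqrt hNpos.le, mul_comm] at h2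
  have h3 : (sqNormInt (v - w) : ℝ) < (M : ℝ) := lt_of_lt_of_le h2 hρ
  exact_mod_cast h3

/-- Transfer of the corner count from the integer model to the scaled pattern. [folklore] -/
theorem triCorners_scaledPattern_le {S : Finset (Fin 3 → ℤ)} {N : ℕ} (hN : N ≠ 0) {M : ℤ}
    (hS : ∀ v ∈ S, (triCornersInt S M v).card ≤ 4) {ρ : ℝ} (hρ : ρ ^ 2 * N ≤ M) :
    ∀ a ∈ scaledPattern S N, (triCorners (scaledPattern S N) ρ a).card ≤ 4 := by
  classical
  intro a ha
  obtain ⟨v, hv, rfl⟩ := Finset.mem_image.1 ha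
  have hinj := scaledPattern_map_injective (N := N) hN
  unfold triCorners scaledPattern
  rw [← Finset.prodMap_image_product, Finset.filter_image,
    Finset.card_image_of_injective _ (hinj.prodMap hinj)]
  refine le_trans (Finset.card_le_card ?_) (hS v hv)
  intro bc hbc
  simp only [triCornersInt, Finset.mem_filter, Finset.mem_product, Prod.map_fst, Prod.map_snd] at hbc ⊢
  obtain ⟨hmem, h1, h2, h12, d1, d2, d12⟩ := hbc
  refine ⟨hmem, fun h => h1 (by rw [h]), fun h => h2 (by rw [h]), fun h => h12 (by rw [h]), ?_, ?_, ?_⟩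
  · exact sqNormInt_lt_of_dist_scaled_lt hN hρ _ _ d1
  · exact sqNormInt_lt_of_dist_scaled_lt hN hρ _ _ d2
  · exact sqNormInt_lt_of_dist_scaled_lt hN hρ _ _ d12

/-- Every point of the fcc pattern lies in at most two bonded triangles: at most four ordered corners
`(b, c)` with `ab, ac, bc < 1.414 (< √2)`. [cite: HalesDSP2012, §1.3 (cuboctahedron)] -/
theorem fcc_triCorners : ∀ a ∈ fccKissingPattern, (triCorners fccKissingPattern 1.414 a).card ≤ 4 :=
  triCorners_scaledPattern_le two_ne_zero fccInt_triCorners (by norm_num)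

/-- Every point of the hcp pattern lies in at most two bonded triangles. [cite: HalesDSP2012, §1.3 (anticuboctahedron)] -/
theorem hcp_triCorners : ∀ a ∈ hcpKissingPattern, (triCorners hcpKissingPattern 1.414 a).card ≤ 4 :=
  triCorners_scaledPattern_le (by norm_num) hcpInt_triCorners (by norm_num)

/-! ### `√q / D` versus integer bounds (two-sided versions of `le_sqrt_div` / `sqrt_div_le`) -/

/-- `√q / D ≤ hi ↔ q ≤ (hi·D)²`. [folklore] -/
theorem sqrt_div_le_iff {D : ℕ} (hD : D ≠ 0) {q hi : ℝ} (hq : 0 ≤ q) (hhi : 0 ≤ hi) :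
    Real.sqrt q / D ≤ hi ↔ q ≤ (hi * D) ^ 2 := by
  have hDpos : (0 : ℝ) < D := by exact_mod_cast Nat.pos_of_ne_zero hD
  rw [div_le_iff₀ hDpos]
  constructor
  · intro h
    calc q = (Real.sqrt q) ^ 2 := (Real.sq_sqrt hq).symm
      _ ≤ (hi * D) ^ 2 := by gcongr
  · intro h
    calc Real.sqrt q ≤ Real.sqrt ((hi * D) ^ 2) := Real.sqrt_le_sqrt h
      _ = hi * D := Real.sqrt_sq (by positivity)

/-- `lo ≤ √q / D ↔ (lo·D)² ≤ q`. [folklore] -/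
theorem le_sqrt_div_iff {D : ℕ} (hD : D ≠ 0) {q lo : ℝ} (hq : 0 ≤ q) (hlo : 0 ≤ lo) :
    lo ≤ Real.sqrt q / D ↔ (lo * D) ^ 2 ≤ q := by
  have hDpos : (0 : ℝ) < D := by exact_mod_cast Nat.pos_of_ne_zero hD
  rw [le_div_iff₀ hDpos]
  constructor
  · intro h
    calc (lo * D) ^ 2 ≤ (Real.sqrt q) ^ 2 := by gcongr
      _ = q := Real.sq_sqrt hq
  · intro h
    calc lo * D = Real.sqrt ((lo * D) ^ 2) := (Real.sqrt_sq (by positivity)).symm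
      _ ≤ Real.sqrt q := Real.sqrt_le_sqrt h

/-! ## (a) Load-bearing hypotheses

### The hard core `49/50 ≤ dist v w` is load-bearing: the inscribed hexagonal antiprism

Drop only the lower bound on pair distances. Then the REGULAR HEXAGONAL ANTIPRISM inscribed in the unit
sphere (edge `0.9194`, all 24 edges bonds `≤ 51/50`, every other pair `≥ 1.517 ≥ 63/50`, all twelve
bond-degrees `= 4`, every vertex in THREE bonded triangles — face vector `(12, 0, 0, 2)`, the "two-hexagon
map") satisfies every remaining hypothesis and none of the four conclusions. Integer model at scale `100`. -/

/-- `ShellTrichotomy` with the hard-core hypothesis `1 - 1/50 ≤ dist v w` deleted (everything else verbatim). [folklore] -/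
def ShellTrichotomyWithoutHardCore : Prop :=
  ∀ T : Finset E3, T.card = 12 → (∀ v ∈ T, 1 - 1 / 50 ≤ ‖v‖ ∧ ‖v‖ ≤ 1 + 1 / 50) →
    (∀ v ∈ T, ∀ w ∈ T, v ≠ w → (dist v w ≤ 1 + 1 / 50 ∨ 63 / 50 ≤ dist v w)) →
    ShellCloseTo (1 / 5) T fccKissingPattern ∨ ShellCloseTo (1 / 5) T hcpKissingPattern ∨
    (∃ v ∈ T, 5 ≤ (T.filter fun w => w ≠ v ∧ dist v w ≤ 1 + 1 / 50).card) ∨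
    (∃ v ∈ T, (T.filter fun w => w ≠ v ∧ dist v w ≤ 1 + 1 / 50).card ≤ 3)

/-- integer model (scale `100`) of the inscribed regular hexagonal antiprism: top hexagon at height
`39`, bottom hexagon (rotated by `30°`) at height `-39`, circumradius `≈ 100`. [folklore] -/
def ApInt : Finset (Fin 3 → ℤ) :=
  {![92, 0, 39], ![46, 80, 39], ![-46, 80, 39], ![-92, 0, 39], ![-46, -80, 39], ![46, -80, 39],
   ![80, 46, -39], ![0, 92, -39], ![-80, 46, -39], ![-80, -46, -39], ![0, -92, -39], ![80, -46, -39]}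

/-- twelve distinct integer vectors. [folklore] -/
theorem ApInt_card : ApInt.card = 12 := by decide
/-- radii in `[98, 102]` (squared). [folklore] -/
theorem ApInt_norm : ∀ v ∈ ApInt, (9604 : ℤ) ≤ sqNormInt v ∧ sqNormInt v ≤ 10404 := by decide
/-- every pair is a bond (`≤ 102²`) or far (`≥ 126²`). [folklore] -/
theorem ApInt_dist : ∀ v ∈ ApInt, ∀ w ∈ ApInt, v ≠ w →
    (sqNormInt (v - w) ≤ 10404 ∨ (15876 : ℤ) ≤ sqNormInt (v - w)) := by decide
/-- all twelve bond-degrees are exactly four. [folklore] -/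
theorem ApInt_degree : ∀ v ∈ ApInt, (ApInt.filter fun w => w ≠ v ∧ sqNormInt (v - w) ≤ 10404).card = 4 := by
  decide
/-- the shortest pair has squared length `8344` (bond `0.9134`). [folklore] -/
theorem ApInt_mindist : ∀ v ∈ ApInt, ∀ w ∈ ApInt, v ≠ w → (8344 : ℤ) ≤ sqNormInt (v - w) := by decide

/-- the fan vertex `t0 = (92, 0, 39)` and its link path top₁ – bot₀ – bot₅ – top₅ [folklore] -/
def apV : Fin 3 → ℤ := ![92, 0, 39]
/-- the link path [folklore] -/
def apN : Fin 4 → (Fin 3 → ℤ) := ![![46, 80, 39], ![80, 46, -39], ![80, -46, -39], ![46, -80, 39]]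
/-- the fan vertex is a witness point. [folklore] -/
theorem apV_mem : apV ∈ ApInt := by decide
/-- its link path lies in the witness. [folklore] -/
theorem apN_mem : ∀ i, apN i ∈ ApInt := by decide
/-- four distinct link points. [folklore] -/
theorem apN_inj : Function.Injective apN := by decide
/-- none of them is the fan vertex. [folklore] -/
theorem apN_ne : ∀ i, apN i ≠ apV := by decide
/-- spokes and link-path edges have squared length `≤ 93² = 8649`. [folklore] -/
theorem apN_spoke : ∀ i, sqNormInt (apV - apN i) ≤ 8649 := by decide
/-- link-path edges `≤ 93/100`. [folklore] -/
theorem apN_path : sqNormInt (apN 0 - apN 1) ≤ 8649 ∧ sqNormInt (apN 1 - apN 2) ≤ 8649 ∧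
    sqNormInt (apN 2 - apN 3) ≤ 8649 := by decide

/-- the witness map `v ↦ v / 100` [folklore] -/
def apmap (v : Fin 3 → ℤ) : E3 := ((100 : ℕ) : ℝ)⁻¹ • intVec v
/-- **the antiprism witness** [folklore] -/
def Ap : Finset E3 := ApInt.image apmap

/-- the witness map is injective. [folklore] -/
theorem apmap_injective : Function.Injective apmap := by
  have hc : ((100 : ℕ) : ℝ)⁻¹ ≠ 0 := by positivity
  exact (smul_right_injective E3 hc).comp intVec_injective
/-- norms of witness points from the integer model. [folklore] -/
theorem norm_apmap (v : Fin 3 → ℤ) : ‖apmap v‖ = Real.sqrt (sqNormInt v : ℝ) / (100 : ℕ) := norm_div_intVec _ _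
/-- distances of witness points from the integer model. [folklore] -/
theorem dist_apmap (v w : Fin 3 → ℤ) : dist (apmap v) (apmap w) = Real.sqrt (sqNormInt (v - w) : ℝ) / (100 : ℕ) :=
  dist_div_intVec _ _ _

/-- bond test in integers: `dist ≤ 51/50 ↔ squared integer distance ≤ 102²`. [folklore] -/
theorem dist_apmap_le_iff (v w : Fin 3 → ℤ) : dist (apmap v) (apmap w) ≤ 1 + 1 / 50 ↔ sqNormInt (v - w) ≤ 10404 := by
  rw [dist_apmap, sqrt_div_le_iff (by norm_num) (Literature.Barriers.AtomisticToContinuum.sqNormInt_nonneg _) (by norm_num)]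
  constructor
  · intro h
    have h' : (sqNormInt (v - w) : ℝ) ≤ ((10404 : ℤ) : ℝ) := by push_cast at h ⊢; nlinarith [h]
    exact_mod_cast h'
  · intro h
    have h' : (sqNormInt (v - w) : ℝ) ≤ ((10404 : ℤ) : ℝ) := by exact_mod_cast h
    push_cast at h' ⊢; nlinarith [h']

/-- hypothesis 1 (cardinality) for the witness. [folklore] -/
theorem Ap_card : Ap.card = 12 := by
  rw [Ap, Finset.card_image_of_injective _ apmap_injective, ApInt_card]

/-- hypothesis 2 (radii) for the witness. [folklore] -/
theorem Ap_norm : ∀ x ∈ Ap, 1 - 1 / 50 ≤ ‖x‖ ∧ ‖x‖ ≤ 1 + 1 / 50 := by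
  intro x hx
  obtain ⟨v, hv, rfl⟩ := Finset.mem_image.1 hx
  obtain ⟨h1, h2⟩ := ApInt_norm v hv
  have h1' : ((9604 : ℤ) : ℝ) ≤ (sqNormInt v : ℝ) := by exact_mod_cast h1
  have h2' : (sqNormInt v : ℝ) ≤ ((10404 : ℤ) : ℝ) := by exact_mod_cast h2
  rw [norm_apmap]
  constructor
  · apply le_sqrt_div (by norm_num) (by norm_num); push_cast at h1' ⊢; nlinarith [h1']
  · apply sqrt_div_le (by norm_num) (by norm_num); push_cast at h2' ⊢; nlinarith [h2']

/-- hypothesis 3 without the hard core (bond or far) for the witness. [folklore] -/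
theorem Ap_dist : ∀ x ∈ Ap, ∀ y ∈ Ap, x ≠ y → (dist x y ≤ 1 + 1 / 50 ∨ 63 / 50 ≤ dist x y) := by
  intro x hx y hy hxy
  obtain ⟨v, hv, rfl⟩ := Finset.mem_image.1 hx
  obtain ⟨w, hw, rfl⟩ := Finset.mem_image.1 hy
  have hvw : v ≠ w := by rintro rfl; exact hxy rfl
  rcases ApInt_dist v hv w hw hvw with h | h
  · exact Or.inl ((dist_apmap_le_iff v w).2 h)
  · right
    have h' : ((15876 : ℤ) : ℝ) ≤ (sqNormInt (v - w) : ℝ) := by exact_mod_cast h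
    rw [dist_apmap]
    apply le_sqrt_div (by norm_num) (by norm_num); push_cast at h' ⊢; nlinarith [h']

/-- bond-degrees of the witness, read off the integer model. [folklore] -/
theorem Ap_degree : ∀ x ∈ Ap, (Ap.filter fun w => w ≠ x ∧ dist x w ≤ 1 + 1 / 50).card = 4 := by
  classical
  intro x hx
  obtain ⟨v, hv, rfl⟩ := Finset.mem_image.1 hx
  rw [← ApInt_degree v hv, Ap, Finset.filter_image, Finset.card_image_of_injective _ apmap_injective]
  congr 1
  apply Finset.filter_congr
  intro w _
  simp only [apmap_injective.ne_iff, dist_apmap_le_iff]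

/-- the witness is `1/5`-close to neither pattern: three bonded triangles fanned at `apV / 100`
(`β = 93/100`, `93/100 + 2/5 < 1.414`). [folklore] -/
theorem Ap_not_close {P : Finset E3} (hP : ∀ a ∈ P, (triCorners P 1.414 a).card ≤ 4) : ¬ ShellCloseTo (1 / 5) Ap P := by
  refine not_shellCloseTo_of_linkPath hP (β := 93 / 100) (by norm_num) (t0 := apmap apV)
    (Finset.mem_image_of_mem _ apV_mem) (fun i => apmap (apN i)) (fun i => Finset.mem_image_of_mem _ (apN_mem i))
    (fun i j h => apN_inj (apmap_injective h)) (fun i h => apN_ne i (apmap_injective h)) ?_ ?_ ?_ ?_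
  · intro i
    have h := apN_spoke i
    have h' : (sqNormInt (apV - apN i) : ℝ) ≤ ((8649 : ℤ) : ℝ) := by exact_mod_cast h
    rw [dist_apmap]; apply sqrt_div_le (by norm_num) (by norm_num); push_cast at h' ⊢; nlinarith [h']
  all_goals
    rw [dist_apmap]; apply sqrt_div_le (by norm_num) (by norm_num)
  · have h' : (sqNormInt (apN 0 - apN 1) : ℝ) ≤ ((8649 : ℤ) : ℝ) := by exact_mod_cast apN_path.1
    push_cast at h' ⊢; nlinarith [h']
  · have h' : (sqNormInt (apN 1 - apN 2) : ℝ) ≤ ((8649 : ℤ) : ℝ) := by exact_mod_cast apN_path.2.1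
    push_cast at h' ⊢; nlinarith [h']
  · have h' : (sqNormInt (apN 2 - apN 3) : ℝ) ≤ ((8649 : ℤ) : ℝ) := by exact_mod_cast apN_path.2.2
    push_cast at h' ⊢; nlinarith [h']

/-- **The hard-core hypothesis is load-bearing**: `ShellTrichotomy` with `49/50 ≤ dist v w` deleted is
FALSE — the inscribed regular hexagonal antiprism (bonds `0.92`) is all-degree-4, gapped, and three-fanned
at every vertex, hence `> 1/5` (bottleneck, after any linear isometry) from both patterns. Any proof of the
crux must use the hard core (it is what forbids short bonds and thereby the `(12,0,0,2)` two-hexagon map,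
whose realisation with bonds `≥ 49/50` needs radii `≥ 1.0659`). [folklore] -/
theorem shellTrichotomy_false_without_hardCore : ¬ ShellTrichotomyWithoutHardCore := by
  intro h
  rcases h Ap Ap_card Ap_norm Ap_dist with hA | hA | ⟨v, hv, h5⟩ | ⟨v, hv, h3⟩
  · exact Ap_not_close fcc_triCorners hA
  · exact Ap_not_close hcp_triCorners hA
  · rw [Ap_degree v hv] at h5; omega
  · rw [Ap_degree v hv] at h3; omega


/-! ### The radius window is load-bearing: a translated cuboctahedron

Drop only the hypothesis `49/50 ≤ ‖v‖ ≤ 51/50`. The fcc pattern translated by `(3, 0, 0)` keeps every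
pair distance (all-degree-4, gapped, hard core) but every point has norm `≥ 2`, while a linear isometry
keeps the pattern on the unit sphere: no `1/5`-matching. (The conclusion's isometries are LINEAR, so the
radius window is what pins the centre; with it, translations are limited to `±1/50`.) -/

/-- `ShellTrichotomy` with the radius hypothesis deleted (everything else verbatim). [folklore] -/
def ShellTrichotomyWithoutRadiusWindow : Prop :=
  ∀ T : Finset E3, T.card = 12 →
    (∀ v ∈ T, ∀ w ∈ T, v ≠ w → 1 - 1 / 50 ≤ dist v w ∧ (dist v w ≤ 1 + 1 / 50 ∨ 63 / 50 ≤ dist v w)) →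
    ShellCloseTo (1 / 5) T fccKissingPattern ∨ ShellCloseTo (1 / 5) T hcpKissingPattern ∨
    (∃ v ∈ T, 5 ≤ (T.filter fun w => w ≠ v ∧ dist v w ≤ 1 + 1 / 50).card) ∨
    (∃ v ∈ T, (T.filter fun w => w ≠ v ∧ dist v w ≤ 1 + 1 / 50).card ≤ 3)

/-- fcc integer model: distinct vectors are at squared distance `2` (bond) or `≥ 4`. [cite: ConwaySloane1999, Ch. 4 §6.3] -/
theorem fccInt_gap : ∀ v ∈ fccInt, ∀ w ∈ fccInt, v ≠ w → sqNormInt (v - w) ≤ 2 ∨ (4 : ℤ) ≤ sqNormInt (v - w) := by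
  decide
/-- fcc integer model: exactly four vectors at squared distance `≤ 2` from each vector. [cite: ConwaySloane1999, Ch. 4 §6.3] -/
theorem fccInt_degree : ∀ v ∈ fccInt, (fccInt.filter fun w => w ≠ v ∧ sqNormInt (v - w) ≤ 2).card = 4 := by
  decide

/-- the scaling map of the fcc pattern [folklore] -/
def fmap (v : Fin 3 → ℤ) : E3 := (Real.sqrt (2 : ℕ))⁻¹ • intVec v

/-- the fcc scaling map is injective. [folklore] -/
theorem fmap_injective : Function.Injective fmap := scaledPattern_map_injective (N := 2) two_ne_zero
/-- the fcc pattern as the image of its integer model (definitional). [folklore] -/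
theorem fcc_eq_image : fccKissingPattern = fccInt.image fmap := rfl

/-- distances in the fcc pattern from the integer model. [folklore] -/
theorem dist_fmap (v w : Fin 3 → ℤ) : dist (fmap v) (fmap w) = (Real.sqrt 2)⁻¹ * Real.sqrt (sqNormInt (v - w) : ℝ) := by
  have hc : (0 : ℝ) ≤ (Real.sqrt (2 : ℕ))⁻¹ := by positivity
  have := dist_scaled_intVec _ hc v w
  simpa [fmap] using this

/-- bond test on the fcc model: `dist ≤ 51/50 ↔ squared integer distance ≤ 2`. [folklore] -/
theorem dist_fmap_le_iff {v w : Fin 3 → ℤ} (hv : v ∈ fccInt) (hw : w ∈ fccInt) (hvw : v ≠ w) :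
    dist (fmap v) (fmap w) ≤ 1 + 1 / 50 ↔ sqNormInt (v - w) ≤ 2 := by
  have hs2 : 0 < Real.sqrt 2 := Real.sqrt_pos.2 (by norm_num)
  have hs2sq : Real.sqrt 2 ^ 2 = 2 := Real.sq_sqrt (by norm_num)
  rw [dist_fmap, inv_mul_le_iff₀ hs2]
  constructor
  · intro h
    rcases fccInt_gap v hv w hw hvw with h2 | h4
    · exact h2
    · exfalso
      have h4' : ((4 : ℤ) : ℝ) ≤ (sqNormInt (v - w) : ℝ) := by exact_mod_cast h4
      have : (2 : ℝ) ≤ Real.sqrt (sqNormInt (v - w) : ℝ) := by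
        rw [show (2 : ℝ) = Real.sqrt (2 ^ 2) by rw [Real.sqrt_sq (by norm_num)]]
        exact Real.sqrt_le_sqrt (by push_cast at h4' ⊢; linarith)
      nlinarith [hs2sq, Real.sqrt_nonneg 2]
  · intro h
    have h' : (sqNormInt (v - w) : ℝ) ≤ ((2 : ℤ) : ℝ) := by exact_mod_cast h
    calc Real.sqrt (sqNormInt (v - w) : ℝ) ≤ Real.sqrt 2 := Real.sqrt_le_sqrt (by push_cast at h' ⊢; linarith)
      _ ≤ Real.sqrt 2 * (1 + 1 / 50) := by nlinarith [Real.sqrt_nonneg 2]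

/-- pair distances of the fcc pattern: `≥ 49/50`, and `≤ 51/50` (the bond `1`) or `≥ 63/50` (`√2, √3, 2`). [cite: HalesDSP2012, §1.3] -/
theorem fcc_pairs : ∀ x ∈ fccKissingPattern, ∀ y ∈ fccKissingPattern, x ≠ y →
    1 - 1 / 50 ≤ dist x y ∧ (dist x y ≤ 1 + 1 / 50 ∨ 63 / 50 ≤ dist x y) := by
  intro x hx y hy hxy
  refine ⟨le_trans (by norm_num) (one_le_dist_of_mem_fccKissingPattern hx hy hxy), ?_⟩
  rw [fcc_eq_image] at hx hy
  obtain ⟨v, hv, rfl⟩ := Finset.mem_image.1 hx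
  obtain ⟨w, hw, rfl⟩ := Finset.mem_image.1 hy
  have hvw : v ≠ w := by rintro rfl; exact hxy rfl
  rcases fccInt_gap v hv w hw hvw with h2 | h4
  · exact Or.inl ((dist_fmap_le_iff hv hw hvw).2 h2)
  · right
    have hs2 : 0 < Real.sqrt 2 := Real.sqrt_pos.2 (by norm_num)
    have hs2sq : Real.sqrt 2 ^ 2 = 2 := Real.sq_sqrt (by norm_num)
    have h4' : ((4 : ℤ) : ℝ) ≤ (sqNormInt (v - w) : ℝ) := by exact_mod_cast h4
    have h2le : (2 : ℝ) ≤ Real.sqrt (sqNormInt (v - w) : ℝ) := by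
      rw [show (2 : ℝ) = Real.sqrt (2 ^ 2) by rw [Real.sqrt_sq (by norm_num)]]
      exact Real.sqrt_le_sqrt (by push_cast at h4' ⊢; linarith)
    rw [dist_fmap, le_inv_mul_iff₀ hs2]
    have hs2lt : Real.sqrt 2 ≤ 3 / 2 := by nlinarith [hs2sq, Real.sqrt_nonneg 2]
    nlinarith

/-- bond-degrees of the fcc pattern are exactly four. [cite: HalesDSP2012, §1.3] -/
theorem fcc_degree : ∀ x ∈ fccKissingPattern,
    (fccKissingPattern.filter fun w => w ≠ x ∧ dist x w ≤ 1 + 1 / 50).card = 4 := by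
  classical
  intro x hx
  rw [fcc_eq_image] at hx ⊢
  obtain ⟨v, hv, rfl⟩ := Finset.mem_image.1 hx
  rw [← fccInt_degree v hv, Finset.filter_image, Finset.card_image_of_injective _ fmap_injective]
  congr 1
  apply Finset.filter_congr
  intro w hw
  simp only [fmap_injective.ne_iff]
  constructor
  · rintro ⟨hne, hd⟩; exact ⟨hne, (dist_fmap_le_iff hv hw (Ne.symm hne)).1 hd⟩
  · rintro ⟨hne, hd⟩; exact ⟨hne, (dist_fmap_le_iff hv hw (Ne.symm hne)).2 hd⟩

/-- the translation vector `(3, 0, 0)` [folklore] -/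
def cvec : E3 := intVec ![3, 0, 0]
/-- its norm is `3`. [folklore] -/
theorem norm_cvec : ‖cvec‖ = 3 := by
  rw [cvec, norm_intVec]
  rw [show ((sqNormInt ![3, 0, 0] : ℤ) : ℝ) = 3 ^ 2 by simp [sqNormInt]; norm_num]
  exact Real.sqrt_sq (by norm_num)

/-- **the translated witness** `fcc + (3,0,0)` [folklore] -/
def Tc : Finset E3 := fccKissingPattern.image fun x => x + cvec

/-- translation is injective. [folklore] -/
theorem tr_injective : Function.Injective fun x : E3 => x + cvec := fun x y h => by simpa using h

/-- twelve points. [folklore] -/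
theorem Tc_card : Tc.card = 12 := by
  rw [Tc, Finset.card_image_of_injective _ tr_injective, card_fccKissingPattern]

/-- pair hypotheses (hard core, bond-or-far) for the translated shell. [folklore] -/
theorem Tc_pairs : ∀ x ∈ Tc, ∀ y ∈ Tc, x ≠ y → 1 - 1 / 50 ≤ dist x y ∧ (dist x y ≤ 1 + 1 / 50 ∨ 63 / 50 ≤ dist x y) := by
  intro x hx y hy hxy
  obtain ⟨a, ha, rfl⟩ := Finset.mem_image.1 hx
  obtain ⟨b, hb, rfl⟩ := Finset.mem_image.1 hy
  have hab : a ≠ b := by rintro rfl; exact hxy rfl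
  have hd : dist (a + cvec) (b + cvec) = dist a b := by simp
  rw [hd]
  exact fcc_pairs a ha b hb hab

/-- all bond-degrees of the translated shell are four. [folklore] -/
theorem Tc_degree : ∀ x ∈ Tc, (Tc.filter fun w => w ≠ x ∧ dist x w ≤ 1 + 1 / 50).card = 4 := by
  classical
  intro x hx
  obtain ⟨a, ha, rfl⟩ := Finset.mem_image.1 hx
  rw [← fcc_degree a ha, Tc, Finset.filter_image, Finset.card_image_of_injective _ tr_injective]
  congr 1
  apply Finset.filter_congr
  intro w _
  simp [tr_injective.ne_iff]

/-- no `1/5`-matching of the translated shell with any isometric copy of a unit-sphere pattern. [folklore] -/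
theorem Tc_not_close {P : Finset E3} (hP : ∀ p ∈ P, ‖p‖ = 1) : ¬ ShellCloseTo (1 / 5) Tc P := by
  classical
  rintro ⟨A, e, he⟩
  have hmem : fmap ![1, 1, 0] + cvec ∈ Tc :=
    Finset.mem_image_of_mem _ (by rw [fcc_eq_image]; exact Finset.mem_image_of_mem _ (by decide))
  set t0 : ↥Tc := ⟨_, hmem⟩ with ht0
  have h1 : ‖(t0 : E3)‖ ≥ 2 := by
    have hp : ‖fmap ![1, 1, 0]‖ = 1 :=
      norm_eq_one_of_mem_fccKissingPattern (by rw [fcc_eq_image]; exact Finset.mem_image_of_mem _ (by decide))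
    have := norm_sub_norm_le cvec (-(fmap ![1, 1, 0]))
    rw [norm_neg, norm_cvec, hp, sub_neg_eq_add, add_comm] at this
    change ‖fmap ![1, 1, 0] + cvec‖ ≥ 2
    linarith
  have h2 : ‖((e t0 : ↥(P.image A)) : E3)‖ = 1 := by
    obtain ⟨p, hp, hpe⟩ := Finset.mem_image.1 (e t0).2
    rw [← hpe, LinearIsometry.norm_map, hP p hp]
  have h3 := he t0
  have h4 : ‖(t0 : E3)‖ - ‖((e t0 : ↥(P.image A)) : E3)‖ ≤ dist (t0 : E3) (e t0 : E3) := by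
    rw [dist_eq_norm]; exact norm_sub_norm_le _ _
  linarith

/-- **The radius window is load-bearing**: `ShellTrichotomy` with `49/50 ≤ ‖v‖ ≤ 51/50` deleted is
FALSE (translated cuboctahedron). Any proof must use the radii — in the crux they fix the centre to
within `1/50`, which is what makes "after a LINEAR isometry" the right closeness notion. [folklore] -/
theorem shellTrichotomy_false_without_radiusWindow : ¬ ShellTrichotomyWithoutRadiusWindow := by
  intro h
  rcases h Tc Tc_card Tc_pairs with hA | hA | ⟨v, hv, h5⟩ | ⟨v, hv, h3⟩
  · exact Tc_not_close (fun p hp => norm_eq_one_of_mem_fccKissingPattern hp) hA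
  · exact Tc_not_close (fun p hp => norm_eq_one_of_mem_hcpKissingPattern hp) hA
  · rw [Tc_degree v hv] at h5; omega
  · rw [Tc_degree v hv] at h3; omega

/-! ### The cardinality hypothesis is load-bearing (degenerately): the empty shell

Without `T.card = 12` the empty set satisfies the other hypotheses vacuously, is matched to nothing,
and has no vertex to be capped or torn. (Degenerate, recorded only so that the hypothesis census is complete.) -/

/-- `ShellTrichotomy` with `T.card = 12` deleted. [folklore] -/
def ShellTrichotomyWithoutCard : Prop :=
  ∀ T : Finset E3, (∀ v ∈ T, 1 - 1 / 50 ≤ ‖v‖ ∧ ‖v‖ ≤ 1 + 1 / 50) →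
    (∀ v ∈ T, ∀ w ∈ T, v ≠ w → 1 - 1 / 50 ≤ dist v w ∧ (dist v w ≤ 1 + 1 / 50 ∨ 63 / 50 ≤ dist v w)) →
    ShellCloseTo (1 / 5) T fccKissingPattern ∨ ShellCloseTo (1 / 5) T hcpKissingPattern ∨
    (∃ v ∈ T, 5 ≤ (T.filter fun w => w ≠ v ∧ dist v w ≤ 1 + 1 / 50).card) ∨
    (∃ v ∈ T, (T.filter fun w => w ≠ v ∧ dist v w ≤ 1 + 1 / 50).card ≤ 3)

/-- the empty shell refutes the card-free variant. [folklore] -/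
theorem shellTrichotomy_false_without_card : ¬ ShellTrichotomyWithoutCard := by
  intro h
  rcases h ∅ (by simp) (by simp) with hA | hA | ⟨v, hv, _⟩ | ⟨v, hv, _⟩
  · have := hA.card_eq; rw [card_fccKissingPattern] at this; simp at this
  · have := hA.card_eq; rw [card_hcpKissingPattern] at this; simp at this
  · simp at hv
  · simp at hv

/-! ## (b) The crux with its six constants as parameters; what is known where -/

/-- `TrichotomyAt rlo rhi dlo dhi gap η`: the crux with radius window `[rlo, rhi]`, bond window
`[dlo, dhi]`, gap threshold `gap` and closeness `η` (`ShellTrichotomy = TrichotomyAt (49/50) (51/50)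
(49/50) (51/50) (63/50) (1/5)`, by `Iff.rfl`). [folklore] -/
def TrichotomyAt (rlo rhi dlo dhi gap η : ℝ) : Prop :=
  ∀ T : Finset E3, T.card = 12 → (∀ v ∈ T, rlo ≤ ‖v‖ ∧ ‖v‖ ≤ rhi) →
    (∀ v ∈ T, ∀ w ∈ T, v ≠ w → dlo ≤ dist v w ∧ (dist v w ≤ dhi ∨ gap ≤ dist v w)) →
    ShellCloseTo η T fccKissingPattern ∨ ShellCloseTo η T hcpKissingPattern ∨
    (∃ v ∈ T, 5 ≤ (T.filter fun w => w ≠ v ∧ dist v w ≤ dhi).card) ∨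
    (∃ v ∈ T, (T.filter fun w => w ≠ v ∧ dist v w ≤ dhi).card ≤ 3)

/-- the crux is the six-parameter form at its constants (definitional). [folklore] -/
theorem shellTrichotomy_iff :
    Summit.AtomisticToContinuum.Crystallization.Theses.GappedShellCensus.ShellTrichotomy ↔
      TrichotomyAt (1 - 1 / 50) (1 + 1 / 50) (1 - 1 / 50) (1 + 1 / 50) (63 / 50) (1 / 5) := Iff.rfl

/-- monotonicity bookkeeping: widening the radius window or lowering the hard core can only make the
statement harder (the variants above are the two extreme widenings). [folklore] -/
theorem trichotomyAt_mono {rlo rlo' rhi rhi' dlo dlo' dhi gap η : ℝ} (hr : rlo' ≤ rlo) (hR : rhi ≤ rhi')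
    (hd : dlo' ≤ dlo) (h : TrichotomyAt rlo' rhi' dlo' dhi gap η) : TrichotomyAt rlo rhi dlo dhi gap η :=
  fun T hc hn hp => h T hc (fun v hv => ⟨hr.trans (hn v hv).1, (hn v hv).2.trans hR⟩)
    fun v hv w hw hvw => ⟨hd.trans (hp v hv w hw hvw).1, (hp v hv w hw hvw).2⟩

/-- **Hard core / radius ratio, quantitatively**: with bonds allowed down to `91/100` (radii, bond
ceiling, gap and `η` as in the crux) the trichotomy is false — same antiprism (its shortest bond is
`√8344/100 = 0.9134`; the regular one has all bonds `0.9194`). Equivalently (by scaling) radii up to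
`≈ 1.087` with unit bonds. The true threshold of the two-hexagon map lies between `0.9194` and `49/50`
(numerically `≈ 1/1.045`, kit j022014 part C). [folklore] -/
theorem not_trichotomyAt_core_091 : ¬ TrichotomyAt (1 - 1 / 50) (1 + 1 / 50) (91 / 100) (1 + 1 / 50) (63 / 50) (1 / 5) := by
  intro h
  have hpairs : ∀ x ∈ Ap, ∀ y ∈ Ap, x ≠ y → 91 / 100 ≤ dist x y ∧ (dist x y ≤ 1 + 1 / 50 ∨ 63 / 50 ≤ dist x y) := by
    intro x hx y hy hxy
    refine ⟨?_, Ap_dist x hx y hy hxy⟩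
    obtain ⟨v, hv, rfl⟩ := Finset.mem_image.1 hx
    obtain ⟨w, hw, rfl⟩ := Finset.mem_image.1 hy
    have hvw : v ≠ w := by rintro rfl; exact hxy rfl
    have hmin : (8344 : ℤ) ≤ sqNormInt (v - w) := ApInt_mindist v hv w hw hvw
    have h' : ((8344 : ℤ) : ℝ) ≤ (sqNormInt (v - w) : ℝ) := by exact_mod_cast hmin
    rw [dist_apmap]
    apply le_sqrt_div (by norm_num) (by norm_num); push_cast at h' ⊢; nlinarith [h']
  rcases h Ap Ap_card Ap_norm hpairs with hA | hA | ⟨v, hv, h5⟩ | ⟨v, hv, h3⟩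
  · exact Ap_not_close fcc_triCorners hA
  · exact Ap_not_close hcp_triCorners hA
  · rw [Ap_degree v hv] at h5; omega
  · rw [Ap_degree v hv] at h3; omega

/-! ### The gap pins `η` from below: a shell with a pair AT the gap is `(√2 − 63/50)/2`-far

If some non-bonded pair of an all-degree-4 gapped shell sits at distance `d ∈ [63/50, 1.2642)`, no
`η`-matching with `2η < min (d − 1, √2 − d)` exists: the matching is injective and distorts distances by
`≤ 2η`, but the patterns have NO pair distance strictly between `1` and `√2`.  Such shells exist (the
soft-mode flexes of either pattern slide the quad diagonals from `√2` down to the gap; witness `Wg` below,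
the rounded bottleneck maximiser of kit j021991), so the crux's closeness constant can never be taken
below `(√2 − 63/50)/2 ≈ 0.0771` — a rigorous (if weak) companion of the numerical tightness `0.1833`. -/

/-- distance-gap obstruction: a shell pair at distance `d` with `1 + 2η < d` and `d + 2η < √2` forbids an
`η`-matching with any isometric copy of a pattern whose pair distances avoid `(1, √2)`. [folklore] -/
theorem not_shellCloseTo_of_gapPair {η : ℝ} {T P : Finset E3}
    (hP : ∀ p ∈ P, ∀ q ∈ P, dist p q ≤ 1 ∨ Real.sqrt 2 ≤ dist p q)
    {a b : EuclideanSpace ℝ (Fin 3)} (ha : a ∈ T) (hb : b ∈ T)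
    (h1 : 1 + 2 * η < dist a b) (h2 : dist a b + 2 * η < Real.sqrt 2) : ¬ ShellCloseTo η T P := by
  classical
  rintro ⟨A, hA⟩
  obtain ⟨f, hfQ, hfinj, hfd⟩ := exists_map_of_etaMatched hA
  obtain ⟨p, hp, hpa⟩ := Finset.mem_image.1 (hfQ a ha)
  obtain ⟨q, hq, hqb⟩ := Finset.mem_image.1 (hfQ b hb)
  have hdist : dist (f a) (f b) = dist p q := by rw [← hpa, ← hqb, LinearIsometry.dist_map]
  have hlo : dist a b ≤ dist a (f a) + dist (f a) (f b) + dist (f b) b := dist_triangle4 _ _ _ _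
  have hhi : dist (f a) (f b) ≤ dist (f a) a + dist a b + dist b (f b) := dist_triangle4 _ _ _ _
  have h3 := hfd a ha
  have h4 := hfd b hb
  rw [dist_comm] at h3
  have h4' : dist (f b) b ≤ η := by rw [dist_comm]; exact hfd b hb
  rcases hP p hp q hq with hle | hge
  · rw [← hdist] at hle; linarith [hfd a ha]
  · rw [← hdist] at hge; linarith [hfd a ha]

/-- a `√N`-scaled integer pattern whose squared integer distances are `≤ N` or `≥ 2N` has real pair
distances `≤ 1` or `≥ √2`. [folklore] -/
theorem dist_dichotomy_scaledPattern {S : Finset (Fin 3 → ℤ)} {N : ℕ} (hN : N ≠ 0)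
    (hS : ∀ v ∈ S, ∀ w ∈ S, sqNormInt (v - w) ≤ N ∨ (2 * N : ℤ) ≤ sqNormInt (v - w)) :
    ∀ p ∈ scaledPattern S N, ∀ q ∈ scaledPattern S N, dist p q ≤ 1 ∨ Real.sqrt 2 ≤ dist p q := by
  intro p hp q hq
  obtain ⟨v, hv, rfl⟩ := Finset.mem_image.1 hp
  obtain ⟨w, hw, rfl⟩ := Finset.mem_image.1 hq
  have hNpos : (0 : ℝ) < N := by exact_mod_cast Nat.pos_of_ne_zero hN
  have hc : (0 : ℝ) ≤ (Real.sqrt N)⁻¹ := by positivity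
  have hsN : 0 < Real.sqrt N := Real.sqrt_pos.2 hNpos
  rw [dist_scaled_intVec _ hc]
  rcases hS v hv w hw with h | h
  · left
    have h' : (sqNormInt (v - w) : ℝ) ≤ (N : ℝ) := by exact_mod_cast h
    rw [inv_mul_le_iff₀ hsN, mul_one]
    calc Real.sqrt (sqNormInt (v - w) : ℝ) ≤ Real.sqrt N := Real.sqrt_le_sqrt h'
      _ = Real.sqrt N := rfl
  · right
    have h' : ((2 * N : ℤ) : ℝ) ≤ (sqNormInt (v - w) : ℝ) := by exact_mod_cast h
    rw [le_inv_mul_iff₀ hsN, ← Real.sqrt_mul hNpos.le]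
    exact Real.sqrt_le_sqrt (by push_cast at h' ⊢; linarith)

/-- fcc: pair distances are `≤ 1` or `≥ √2`. [cite: ConwaySloane1999, Ch. 4 §6.3] -/
theorem fcc_dist_dichotomy : ∀ p ∈ fccKissingPattern, ∀ q ∈ fccKissingPattern, dist p q ≤ 1 ∨ Real.sqrt 2 ≤ dist p q :=
  dist_dichotomy_scaledPattern two_ne_zero (by decide)

/-- hcp: pair distances are `≤ 1` or `≥ √2`. [cite: HalesDSP2012, §1.3] -/
theorem hcp_dist_dichotomy : ∀ p ∈ hcpKissingPattern, ∀ q ∈ hcpKissingPattern, dist p q ≤ 1 ∨ Real.sqrt 2 ≤ dist p q :=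
  dist_dichotomy_scaledPattern (by norm_num) (by decide)

/-- integer model (units of `10⁻⁶`) of the gap-pair witness: a feasible all-degree-4 gapped shell on the
anticuboctahedron graph with a quad diagonal at the gap (rounded bottleneck maximiser of kit j021991). [folklore] -/
def WgInt : Finset (Fin 3 → ℤ) :=
  {![750773, -657792, 53308],
   ![-755319, 653247, -44218],
   ![653247, -44218, -755319],
   ![-657792, 53308, 750773],
   ![53308, 750773, -657792],
   ![-44218, -755319, 653247],
   ![793863, 600926, -962],
   ![600926, -962, 793863],
   ![-962, 793863, 600926],
   ![-328292, -135355, -930180],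
   ![-135355, -930180, -328292],
   ![-930180, -328292, -135355]}

/-- the two ends of the pair at the gap [folklore] -/
def Wga : Fin 3 → ℤ := ![750773, -657792, 53308]
/-- (second end) [folklore] -/
def Wgb : Fin 3 → ℤ := ![793863, 600926, -962]

/-- twelve distinct vectors. [folklore] -/
theorem WgInt_card : WgInt.card = 12 := by decide

/-- radii in `[49/50, 51/50]` (squared, units `10⁻¹²`). [folklore] -/
theorem WgInt_norm : ∀ v ∈ WgInt, (960400000000 : ℤ) ≤ sqNormInt v ∧ sqNormInt v ≤ 1040400000000 := by decide

/-- pairs: hard core, and bond (`≤ 1.02²`) or far (`≥ 1.26²`). [folklore] -/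
theorem WgInt_dist : ∀ v ∈ WgInt, ∀ w ∈ WgInt, v ≠ w →
    (960400000000 : ℤ) ≤ sqNormInt (v - w) ∧ (sqNormInt (v - w) ≤ 1040400000000 ∨ (1587600000000 : ℤ) ≤ sqNormInt (v - w)) := by
  decide

/-- all bond-degrees are four. [folklore] -/
theorem WgInt_degree : ∀ v ∈ WgInt, (WgInt.filter fun w => w ≠ v ∧ sqNormInt (v - w) ≤ 1040400000000).card = 4 := by
  decide

/-- the pair ends are witness points. [folklore] -/
theorem Wga_mem : Wga ∈ WgInt := by decide
/-- (second end) [folklore] -/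
theorem Wgb_mem : Wgb ∈ WgInt := by decide

/-- the pair sits at the gap: squared distance in `[1.26², 1589172984524·10⁻¹²]`. [folklore] -/
theorem Wgab_dist : (1587600000000 : ℤ) ≤ sqNormInt (Wga - Wgb) ∧ sqNormInt (Wga - Wgb) ≤ 1589172984524 := by decide

/-- the witness map `v ↦ v / 10⁶` [folklore] -/
def mmap (v : Fin 3 → ℤ) : E3 := ((1000000 : ℕ) : ℝ)⁻¹ • intVec v
/-- **the gap-pair witness shell** [folklore] -/
def Wg : Finset E3 := WgInt.image mmap

/-- the witness map is injective. [folklore] -/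
theorem mmap_injective : Function.Injective mmap := by
  have hc : ((1000000 : ℕ) : ℝ)⁻¹ ≠ 0 := by positivity
  exact (smul_right_injective E3 hc).comp intVec_injective
/-- norms from the integer model. [folklore] -/
theorem norm_mmap (v : Fin 3 → ℤ) : ‖mmap v‖ = Real.sqrt (sqNormInt v : ℝ) / (1000000 : ℕ) := norm_div_intVec _ _
/-- distances from the integer model. [folklore] -/
theorem dist_mmap (v w : Fin 3 → ℤ) : dist (mmap v) (mmap w) = Real.sqrt (sqNormInt (v - w) : ℝ) / (1000000 : ℕ) :=
  dist_div_intVec _ _ _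

/-- bond test in integers at scale `10⁶`. [folklore] -/
theorem dist_mmap_le_iff (v w : Fin 3 → ℤ) : dist (mmap v) (mmap w) ≤ 1 + 1 / 50 ↔ sqNormInt (v - w) ≤ 1040400000000 := by
  rw [dist_mmap, sqrt_div_le_iff (by norm_num) (Literature.Barriers.AtomisticToContinuum.sqNormInt_nonneg _) (by norm_num)]
  constructor
  · intro h
    have h' : (sqNormInt (v - w) : ℝ) ≤ ((1040400000000 : ℤ) : ℝ) := by push_cast at h ⊢; nlinarith [h]
    exact_mod_cast h'
  · intro h
    have h' : (sqNormInt (v - w) : ℝ) ≤ ((1040400000000 : ℤ) : ℝ) := by exact_mod_cast h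
    push_cast at h' ⊢; nlinarith [h']

/-- twelve points. [folklore] -/
theorem Wg_card : Wg.card = 12 := by
  rw [Wg, Finset.card_image_of_injective _ mmap_injective, WgInt_card]

/-- radii hypothesis. [folklore] -/
theorem Wg_norm : ∀ x ∈ Wg, 1 - 1 / 50 ≤ ‖x‖ ∧ ‖x‖ ≤ 1 + 1 / 50 := by
  intro x hx
  obtain ⟨v, hv, rfl⟩ := Finset.mem_image.1 hx
  obtain ⟨h1, h2⟩ := WgInt_norm v hv
  have h1' : ((960400000000 : ℤ) : ℝ) ≤ (sqNormInt v : ℝ) := by exact_mod_cast h1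
  have h2' : (sqNormInt v : ℝ) ≤ ((1040400000000 : ℤ) : ℝ) := by exact_mod_cast h2
  rw [norm_mmap]
  constructor
  · apply le_sqrt_div (by norm_num) (by norm_num); push_cast at h1' ⊢; nlinarith [h1']
  · apply sqrt_div_le (by norm_num) (by norm_num); push_cast at h2' ⊢; nlinarith [h2']

/-- pair hypotheses (hard core; bond or far). [folklore] -/
theorem Wg_dist : ∀ x ∈ Wg, ∀ y ∈ Wg, x ≠ y → 1 - 1 / 50 ≤ dist x y ∧ (dist x y ≤ 1 + 1 / 50 ∨ 63 / 50 ≤ dist x y) := by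
  intro x hx y hy hxy
  obtain ⟨v, hv, rfl⟩ := Finset.mem_image.1 hx
  obtain ⟨w, hw, rfl⟩ := Finset.mem_image.1 hy
  have hvw : v ≠ w := by rintro rfl; exact hxy rfl
  obtain ⟨h1, h2⟩ := WgInt_dist v hv w hw hvw
  have h1' : ((960400000000 : ℤ) : ℝ) ≤ (sqNormInt (v - w) : ℝ) := by exact_mod_cast h1
  refine ⟨?_, ?_⟩
  · rw [dist_mmap]; apply le_sqrt_div (by norm_num) (by norm_num); push_cast at h1' ⊢; nlinarith [h1']
  · rcases h2 with h2 | h2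
    · exact Or.inl ((dist_mmap_le_iff v w).2 h2)
    · right
      have h2' : ((1587600000000 : ℤ) : ℝ) ≤ (sqNormInt (v - w) : ℝ) := by exact_mod_cast h2
      rw [dist_mmap]; apply le_sqrt_div (by norm_num) (by norm_num); push_cast at h2' ⊢; nlinarith [h2']

/-- all bond-degrees of the witness are four. [folklore] -/
theorem Wg_degree : ∀ x ∈ Wg, (Wg.filter fun w => w ≠ x ∧ dist x w ≤ 1 + 1 / 50).card = 4 := by
  classical
  intro x hx
  obtain ⟨v, hv, rfl⟩ := Finset.mem_image.1 hx
  rw [← WgInt_degree v hv, Wg, Finset.filter_image, Finset.card_image_of_injective _ mmap_injective]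
  congr 1
  apply Finset.filter_congr
  intro w _
  simp only [mmap_injective.ne_iff, dist_mmap_le_iff]

/-- `√2 > 1.4142`. [folklore] -/
theorem sqrt_two_gt : (1.4142 : ℝ) < Real.sqrt 2 := by
  rw [show (1.4142 : ℝ) = Real.sqrt (1.4142 ^ 2) by rw [Real.sqrt_sq (by norm_num)]]
  exact Real.sqrt_lt_sqrt (by norm_num) (by norm_num)

/-- **`η`-tightness, rigorous part**: with every other constant as in the crux, the closeness constant
cannot be lowered to `3/40 = 0.075` — the witness `Wg` is a feasible all-degree-4 gapped shell with a
(non-bonded) pair at distance `∈ [63/50, 1.2642)`, hence more than `0.15/2`-far in the distance sense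
from both patterns (their pair distances avoid `(1, √2)`); the degree escapes fail since all degrees are
four.  Mechanism: the gap `63/50` is attained on the feasible set (soft modes slide quad diagonals from
`√2` to the gap), so `η ≥ (√2 − 63/50)/2 ≈ 0.0771` is forced by the distance relaxation alone; the
numerical bottleneck optimum is `0.1833` (NEAR-MISS `not_trichotomyAt_eta_018` in the workfile). [folklore] -/
theorem not_trichotomyAt_eta_0075 :
    ¬ TrichotomyAt (1 - 1 / 50) (1 + 1 / 50) (1 - 1 / 50) (1 + 1 / 50) (63 / 50) (3 / 40) := by
  intro h
  have ha : mmap Wga ∈ Wg := Finset.mem_image_of_mem _ Wga_mem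
  have hb : mmap Wgb ∈ Wg := Finset.mem_image_of_mem _ Wgb_mem
  obtain ⟨hq1, hq2⟩ := Wgab_dist
  have hq1' : ((1587600000000 : ℤ) : ℝ) ≤ (sqNormInt (Wga - Wgb) : ℝ) := by exact_mod_cast hq1
  have hq2' : (sqNormInt (Wga - Wgb) : ℝ) ≤ ((1589172984524 : ℤ) : ℝ) := by exact_mod_cast hq2
  have hd1 : 63 / 50 ≤ dist (mmap Wga) (mmap Wgb) := by
    rw [dist_mmap]; apply le_sqrt_div (by norm_num) (by norm_num); push_cast at hq1' ⊢; nlinarith [hq1']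
  have hd2 : dist (mmap Wga) (mmap Wgb) ≤ 1.2642 := by
    rw [dist_mmap]; apply sqrt_div_le (by norm_num) (by norm_num); push_cast at hq2' ⊢; nlinarith [hq2']
  have h1 : 1 + 2 * (3 / 40 : ℝ) < dist (mmap Wga) (mmap Wgb) := by linarith
  have h2 : dist (mmap Wga) (mmap Wgb) + 2 * (3 / 40 : ℝ) < Real.sqrt 2 := by linarith [sqrt_two_gt]
  rcases h Wg Wg_card Wg_norm Wg_dist with hA | hA | ⟨v, hv, h5⟩ | ⟨v, hv, h3⟩
  · exact not_shellCloseTo_of_gapPair fcc_dist_dichotomy ha hb h1 h2 hA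
  · exact not_shellCloseTo_of_gapPair hcp_dist_dichotomy ha hb h1 h2 hA
  · rw [Wg_degree v hv] at h5; omega
  · rw [Wg_degree v hv] at h3; omega

/-! ## (d) TARGETS — line `Sketch` (lead prover-line-…-18070-0, skeleton v5 `Lines/Sketch.lean`, six stubs)

No stub is broken; one is VERIFIED in its own finite terms and its load-bearing hypotheses are identified.
Evidence on the crux item: `stub_censusCore.md`, `census_core_job.py` (2026-08-17).

* `stub_censusCore` (abstract: `bond`, `tri`, `ang` ⊢ bond graph ≅ cubo / anticubo / labelled antiprism).
  REDUCTION: the angle hypotheses never couple two labels, so the LP in `ang` is feasible iff at every label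
  some corner is free or the corner bounds sum to `≥ 2π`; with bond-degree 4 the only dead corner multisets are
  `4T` (`302.1°`), `3T+Q` and `3T+2H` (both `358.97°`).  `tri` is a closed surface with `χ = 2`: the sphere, or
  `RP²₆ ⊔ RP²₆` (then `bond = K₆ − M` per component and some bonded 3-clique is a non-face of the
  hemi-icosahedron for every perfect matching `M` — killed by `bond_tri`; sphere ⊔ torus splits die on degrees).
  ENUMERATION (pure python, 40 s, count-certified: sphere triangulations by vertex splitting from `K₄`, level
  counts `1,1,2,5,14,50,233,1249,7595` = OEIS A000109, `130` of min degree `≥ 4` = plantri): `723` pairs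
  `(tri, bond)` (`721` with `bond_tri`), `14` bond graphs = the `13` connected four-regular plane maps
  [`(8,6)×5`, `(9,4,1)×2`, `(10,2,2)×3`, `(12,0,0,2)×3`] + octahedron ⊔ octahedron; `62` surviving pairs, ALL
  cubo (12) / anticubo (33) / antiprism (17).  ⇒ the finite content of the stub HOLDS (third independent
  confirmation of the 13-map census, from the triangulation side).
  LOAD-BEARING (same data, hypothesis mutated): drop `qCorner` ⇒ six exotic maps survive (FALSE); drop
  `hCorner` ⇒ the same six survive (FALSE); drop `bond_tri` ⇒ unchanged (NOT needed by the core); T bound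
  `arccos (1/4) = 75.52°` → `76.35°` (the decoupled corner maximum) ⇒ six maps survive: the coupled
  `stub_tCornerMax` is load-bearing, the census half needs `T < (360° − 2·arccos (807/2000))/3 = 75.865°`
  (slack `0.77°` over the coupled maximum `75.10°`; budget slack `1.03°`).
  IN THE KERNEL (`Theorems/ShellTrichotomy/Negative/CensusCoreWithoutQCorner.lean` p142881, `…WithoutHCorner.lean`
  p142883, tools `CensusCoreTools.lean` p142875 — all ACCEPTED):
  `stub_censusCore_false_without_qCorner`, `stub_censusCore_false_without_hCorner` — the stub with that one
  hypothesis deleted, verbatim otherwise, is false: explicit `(9,4,1)` witnesses (sphere triangulation, bitmask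
  bond graph, rational angle table `T = 72°`, `H ≤ 60°`, `Q ≤ 120°`; `2π/5 ≤ arccos (1/4)` from
  `cos (2π/5) = (√5−1)/4`, `π/3 ≤ arccos (807/2000)`), refuted against all three disjuncts by the
  relabelling-invariant bonded-3-clique count `9 ∉ {8, 8, 12}` (`cliqueCount_relabel`); link connectivity by
  explicit chains (`link_of_chain`).  Lesson for whoever proves the core by `decide`: state the finite facts over
  `List`s / `Fin 12` — `∀ S ∈ (tri : Finset (Finset (Fin 12)))` goes through `Finset.attach` in the kernel and
  costs ≈ 40 s per quantifier on twenty triangles.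
* `stub_fanStruct` / `stub_fanAngles` (dictionary): no degenerate break — `fanTriSets` fan-triangulates
  non-simplicial facets from `fVert X c 0` (the exact cuboctahedron's cospherical squares are fine), `u` is
  injective (same ray ⇒ distance `≤ 0.04`), a bonded triangle admits no fourth cospherical point on its facet
  (arc gaps `≥ 106°` inside a `120°` arc), consistent with the landed `stub_bondTriangleFacet`.
* `stub_noAntiprism`: numerically dead at `τ = 1/50` (threshold `τ* ≈ 0.0425`, kit j022014 C; the far pairs are
  slack at the optimum, so the radius window, not the gap, kills it).  IN THE KERNEL:
  `stub_noAntiprism_false_without_radiusWindow` (`Negative/NoAntiprismWithoutRadiusWindow.lean`, p143450): delete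
  `hn` and the stub is FALSE — `apT = apVec/92`, the inscribed antiprism rescaled so its edges are bonds
  `0.9929…1.0109`, other pairs `≥ 1.369`, radii `1.087`, labelled in the stub's order.  With
  `shellTrichotomy_false_without_hardCore` above (same solid inscribed, bonds `0.92`) this brackets the stub: the
  COUPLING of radius ceiling `51/50` and bond floor `49/50` (ratio `1.041 < 1.045`) is what excludes the two-hexagon map.
* `stub_fccClose` / `stub_hcpClose` (`TupleClose` = linear isometry + relabelling; all graph automorphisms of both
  patterns are geometric): sup bottleneck `0.1435` / `0.18328 < 1/5` (kit j021991; j022259 re-verification by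
  4·10⁵ rotations; j022261 externally seeded ascent: same two attractors `0.1833`, `0.1779`); WITHOUT the gap
  `0.2360` / `0.2608 > 1/5` (j022094) ⇒ the gap is load-bearing for both metric stubs (numerical; formal version =
  NEAR-MISS `shellTrichotomy_false_without_gap` below).  Margin of `stub_hcpClose`: `0.0167`.
* Joint sufficiency: `shellTrichotomy_of_stubs` is sorry-free glue — nothing to attack.
-/

/-! ## (e) NEAR-MISSES (the only `sorry`s in this workfile; obstruction + what was tried in each docstring) -/

/-- `ShellTrichotomy` with the GAP hypothesis deleted: pair distances only `≥ 49/50`, bonds still read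
at `≤ 51/50` (so the degree escapes (B)/(C) are unchanged). [folklore] -/
def ShellTrichotomyWithoutGap : Prop :=
  ∀ T : Finset E3, T.card = 12 → (∀ v ∈ T, 1 - 1 / 50 ≤ ‖v‖ ∧ ‖v‖ ≤ 1 + 1 / 50) →
    (∀ v ∈ T, ∀ w ∈ T, v ≠ w → 1 - 1 / 50 ≤ dist v w) →
    ShellCloseTo (1 / 5) T fccKissingPattern ∨ ShellCloseTo (1 / 5) T hcpKissingPattern ∨
    (∃ v ∈ T, 5 ≤ (T.filter fun w => w ≠ v ∧ dist v w ≤ 1 + 1 / 50).card) ∨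
    (∃ v ∈ T, (T.filter fun w => w ≠ v ∧ dist v w ≤ 1 + 1 / 50).card ≤ 3)

/-- NEAR-MISS (gap-dropping): NUMERICALLY FALSE, not formalised.  Without the `63/50` gap (far pairs
only `> 51/50`, so the degree escapes are unchanged) the hcp twist runs past the diagonal cut and the
same nonsmooth ascent reaches bottleneck distance `D = 0.2608 > 1/5` from BOTH patterns at `τ = 1/50`
on the hcp graph (kit j022094, 25 seeds at `0.2555–0.2608`; quad diagonals down to `≈ 1.07`) and
`D = 0.2360` on the fcc graph (jitterbug until a square diagonal reaches the bond ceiling `1.0206`): the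
gap is load-bearing by `≈ 0.06` in `η` for both families.  What blocks
the Lean proof is again the rotation quantifier (the cheap certificates need a `3T`-fanned vertex with
fan bonds `< 1.0142`, and the gap-free `3T+Q` maps realise only from `τ ≈ 0.021` with long fan bonds —
map0: penalty `3·10⁻⁶` at `0.02`, kit j022014 B).  Tried for a cheap witness: icosahedron minus a perfect
matching (3T needs an obtuse rhombus corner `> 144°`, forcing the removed diagonal below the bond length —
infeasible); map0/map1/map3 and cubo/hcp double swaps without gap (penalties `3·10⁻⁶ … 10⁻¹`). [folklore] -/
theorem shellTrichotomy_false_without_gap : ¬ ShellTrichotomyWithoutGap := by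
  sorry

/-- the bottleneck MAXIMISER of kit j021991 (integer model, units `10⁻⁶`; anticuboctahedron bond graph;
radii at both ends of `[0.98, 1.02]`, 8 bonds at `1.02`, 3 at `0.98`, five far pairs at the gap `1.2600x`):
bottleneck distance `0.18328` from hcp and `0.3154` from fcc, independently re-verified by 400 k random
rotations + Nelder–Mead refinement (kit j022259).  Documentation only — the test object for any future
rotation-space certificate. [folklore] -/
def MaxHcpInt : Finset (Fin 3 → ℤ) :=
  {![733654, -706046, 59400],
   ![-751913, 626825, -47429],
   ![670881, -77875, -725365],
   ![-628478, 28664, 768058],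
   ![67382, 734570, -645279],
   ![-11673, -746812, 694493],
   ![816177, 550778, 22407],
   ![630428, -14074, 801507],
   ![12753, 764426, 613264],
   ![-309480, -174472, -913413],
   ![-143179, -966384, -292813],
   ![-906856, -379171, -112502]}

/-- NEAR-MISS (η-tightness), numerically solid, NOT formalised: the closeness constant cannot be lowered
to `0.18` — `MaxHcpInt / 10⁶` is a feasible all-degree-4 gapped shell at bottleneck distance `0.18328`
from hcp and `0.3154` from fcc (kit j021991: twelve independent seeds of the nonsmooth ascent converge to
`0.18323–0.18328`, a second attractor sits at `0.17794`; kit j022259 re-verifies both by dense rotation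
sampling).  The rigorous part is `not_trichotomyAt_eta_0075` above.  Obstruction to a Lean proof of this
one: "far from `A(P)` for EVERY linear isometry `A`" is a continuous quantifier; the distance-only
relaxation (an `η`-matching distorts distances by `≤ 2η`) certifies nothing beyond `η < 0.0771` here (the
identity labelling to hcp is distance-compatible), so a certificate must subdivide `SO(3)` (boxes of
rotation vectors around each anchor-bond frame, Lipschitz bound `max ‖x‖`) — `≈ 10⁶` boxes natively,
not attempted in Lean this cycle. [folklore] -/
theorem not_trichotomyAt_eta_018 :
    ¬ TrichotomyAt (1 - 1 / 50) (1 + 1 / 50) (1 - 1 / 50) (1 + 1 / 50) (63 / 50) (18 / 100) := by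
  sorry

/-- NEAR-MISS (τ-monotonicity of the exotic maps), numerically solid, NOT formalised: at bond/radius
tolerance `τ = 7/200 = 0.035` (gap `63/50`, `η = 1/5`) the trichotomy is FALSE — map0 (an `(8,6)` map
with two `3T+Q` vertices) and the cuboctahedron double swap (`(10,2,2)`, six `3T+P` vertices) realise
from `τ ≈ 0.033–0.034` (kit j022014 A/B; rattack: `0.032–0.034`).  Obstruction to a cheap Lean proof:
at threshold the `3T` fans are maximally strained (fan bonds `≈ 1 + τ > 1.0142`), so the link-path
obstruction needs `η < (√2 − 1.035)/2 ≈ 0.1896 < 1/5`; a witness deeper inside (`τ ≈ 0.05`) with short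
fan bonds, or the rotation certificate, would close it. [folklore] -/
theorem not_trichotomyAt_tau_0035 :
    ¬ TrichotomyAt (1 - 7 / 200) (1 + 7 / 200) (1 - 7 / 200) (1 + 7 / 200) (63 / 50) (1 / 5) := by
  sorry

end Summit.AtomisticToContinuum.Crystallization.Cruxes.ShellTrichotomy.Disproof

end
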